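import Summits.CriticalPhenomena.PercolationContinuityZ3.Theorems.PercNearOneGluingNoHeavyLowerTailSahiE3ExchangeNested
import Mathlib.Tactic.Linarith
import Mathlib.Tactic.Ring
import Mathlib.Tactic.Positivity
import HarnessLib
import HarnessLib.Audit

/-!
# `NoHeavyLowerTail` (crux stmt-CriticalPhenomena-4575), Sahi programme P4: the 2×2 exchange lemma — one-side-nested classes, corners meeting the slot off the INNER annulus

Support file (cell `prim-l12`, seat P4, generation 26; `--supports stmt-CriticalPhenomena-4575`).  No named facts, no sorries;
standard axioms; def-free.  Companion of `…SahiE3ExchangeNestedCorner` (same generation), which weakens the slot-null corner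
hypothesis of `…SahiE3ExchangeNested` to "the corner's slot-trace avoids the opposite annulus `P∖O` (resp. `P'∖O'`)".  Here the
condition is weakened further to the INNER annulus only: for the unprimed-nested orientation `L ⊆ K` with packing
`(K, K'∩L')`, `(L, K'∪L')` (deficit `need(K∖L, L'∖(K'∩L'))`) it suffices that
  `O' ∩ V ∩ (K ∖ O) = ∅`  (the primed corner may meet the outer annulus `P∖K`), with Harris for `(P', K∩V)` and `(P, O'∩V)`, or
  `O ∩ V ∩ (L' ∖ O') = ∅` (the unprimed corner may meet `P'∖L'`), with Harris for `(P, L'∩V)` and `(P', O∩V)`;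
and symmetrically for `K ⊆ L`.  Proof (first case): modularity of `w` over `(P∖K) × (P'∖O')` on `V` gives
`a(PP') + a(KO') ≥ a(KP') + a(PO')`, the trace condition gives `a(KO') = a(OO')`, so
`X_a ≥ Har(P';K_V) + Har(P;O'_V) + w(P')·(a(K) − a(O))`, and the gen-21 bookkeeping closes.  These certificates were found by a
pointwise LP over membership profiles (HOME memo, gen 26) and hold with constant multipliers, i.e. for every block where the two
Harris products hold; numerically 0 failures on Bool³ / 3×3 (≈ 3·10⁶ configurations × both brackets, plus non-FKG weights for the
algebraic remainder).
-/

namespace Summit.CriticalPhenomena.PercolationContinuityZ3.Theorems.SahiE3ExchangeNestedInner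

open Finset SahiE3DimerPacking SahiE3ExchangeCross SahiE3ExchangeEmptyLayer SahiE3ExchangeNested
open scoped BigOperators

variable {B : Type*} [DecidableEq B]

/-- **Nested unprimed side `L ⊆ K`, corner `O'` with trace off the INNER unprimed annulus (`O' ∩ V ∩ (K∖O) = ∅`; `O'` may meet
`P∖K`).**  Packing `(K, K'∩L')`, `(L, K'∪L')`; Harris for `(P', K∩V)` and `(P, O'∩V)`; bracket `Y ≥ (w(K)−w(L))·(w(L')−w(K'∩L'))`.
Proof: `X_a ≥ Har(P';K_V) + Har(P;O'_V) + w(P')·(a(K)−a(O))` by the modularity of `w` over `(P∖K)×(P'∖O')` and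
`a(K∩O') = a(O∩O')`. [this work] -/
theorem exchange_nestedLK_cornerInnerO' [Fintype B] (w R : B → ℝ) (hw : ∀ b, 0 ≤ w b) (hw1 : ∑ b, w b = 1)
    (V K L P O K' L' P' O' : Finset B) (Y : ℝ) (hR : ∀ b ∈ V, 0 ≤ R b)
    (hOL : O ⊆ L) (hLK : L ⊆ K) (hKP : K ⊆ P) (hOK' : O' ⊆ K') (hOL' : O' ⊆ L') (hKP' : K' ⊆ P') (hLP' : L' ⊆ P')
    (hO'V : (O' ∩ (K \ O)) ∩ V = ∅)
    (hHarPO' : (∑ b ∈ P, w b) * (∑ b ∈ O' ∩ V, w b) ≤ ∑ b ∈ (P ∩ O') ∩ V, w b)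
    (hHarP'K : (∑ b ∈ P', w b) * (∑ b ∈ K ∩ V, w b) ≤ ∑ b ∈ (K ∩ P') ∩ V, w b)
    (hpair₁ : (∑ b ∈ K, w b) * (∑ b ∈ (K' ∩ L') ∩ V, w b) + (∑ b ∈ K' ∩ L', w b) * (∑ b ∈ K ∩ V, w b)
        - (∑ b ∈ V, w b) * (∑ b ∈ K, w b) * (∑ b ∈ K' ∩ L', w b) ≤ ∑ b ∈ (K ∩ (K' ∩ L')) ∩ V, R b)
    (hpair₂ : (∑ b ∈ L, w b) * (∑ b ∈ (K' ∪ L') ∩ V, w b) + (∑ b ∈ K' ∪ L', w b) * (∑ b ∈ L ∩ V, w b)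
        - (∑ b ∈ V, w b) * (∑ b ∈ L, w b) * (∑ b ∈ K' ∪ L', w b) ≤ ∑ b ∈ (L ∩ (K' ∪ L')) ∩ V, R b)
    (hY : ((∑ b ∈ K, w b) - ∑ b ∈ L, w b) * ((∑ b ∈ L', w b) - ∑ b ∈ K' ∩ L', w b) ≤ Y) :
    0 ≤ (∑ b ∈ (P ∩ P') ∩ V, w b) + (∑ b ∈ (O ∩ O') ∩ V, w b)
        - (∑ b ∈ P, w b) * (∑ b ∈ O' ∩ V, w b) - (∑ b ∈ P', w b) * (∑ b ∈ O ∩ V, w b)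
        + (∑ b ∈ (K ∩ K') ∩ V, R b) + (∑ b ∈ (L ∩ L') ∩ V, R b)
        - ((∑ b ∈ K, w b) * (∑ b ∈ L' ∩ V, w b) + (∑ b ∈ L', w b) * (∑ b ∈ K ∩ V, w b)
            - (∑ b ∈ V, w b) * (∑ b ∈ K, w b) * (∑ b ∈ L', w b))
        - ((∑ b ∈ L, w b) * (∑ b ∈ K' ∩ V, w b) + (∑ b ∈ K', w b) * (∑ b ∈ L ∩ V, w b)
            - (∑ b ∈ V, w b) * (∑ b ∈ L, w b) * (∑ b ∈ K', w b))
        + (1 - ∑ b ∈ V, w b) * Y := by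
  have hsup := nestedLK_footprints_le_supply R V K L K' L' hR hLK
  have hcD := trace_diff_le w V K L hw hLK
  have hlk : ∑ b ∈ L, w b ≤ ∑ b ∈ K, w b := sum_le_sum_of_subset' w hw hLK
  have hkp : ∑ b ∈ K, w b ≤ ∑ b ∈ P, w b := sum_le_sum_of_subset' w hw hKP
  have haLK : ∑ b ∈ L ∩ V, w b ≤ ∑ b ∈ K ∩ V, w b := sum_le_sum_of_subset' w hw (Finset.inter_subset_inter hLK le_rfl)
  have haOL : ∑ b ∈ O ∩ V, w b ≤ ∑ b ∈ L ∩ V, w b := sum_le_sum_of_subset' w hw (Finset.inter_subset_inter hOL le_rfl)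
  have hJ : ∑ b ∈ K' ∪ L', w b = ∑ b ∈ K', w b + ∑ b ∈ L', w b - ∑ b ∈ K' ∩ L', w b := by
    have := sum_union_trace w (Finset.univ : Finset B) K' L'
    simpa only [Finset.inter_univ] using this
  have hJV := sum_union_trace w V K' L'
  rw [hJ, hJV] at hpair₂
  have h4 : ∑ b ∈ K', w b + ∑ b ∈ L', w b ≤ ∑ b ∈ P', w b + ∑ b ∈ K' ∩ L', w b := by
    have := union_inter_le w (Finset.univ : Finset B) K' L' P' (fun b _ => hw b) hKP' hLP'
    simpa only [Finset.inter_univ] using this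
  have hv1 : ∑ b ∈ V, w b ≤ 1 := by
    rw [← hw1]; exact sum_le_sum_of_subset' w hw (Finset.subset_univ V)
  have hk0 : 0 ≤ ∑ b ∈ K, w b := Finset.sum_nonneg fun b _ => hw b
  have hl0 : 0 ≤ ∑ b ∈ L, w b := Finset.sum_nonneg fun b _ => hw b
  have hp0 : 0 ≤ ∑ b ∈ P, w b := Finset.sum_nonneg fun b _ => hw b
  have hp'0 : 0 ≤ ∑ b ∈ P', w b := Finset.sum_nonneg fun b _ => hw b
  have hk'0 : 0 ≤ ∑ b ∈ K', w b := Finset.sum_nonneg fun b _ => hw b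
  have hl'0 : 0 ≤ ∑ b ∈ L', w b := Finset.sum_nonneg fun b _ => hw b
  have hm'0 : 0 ≤ ∑ b ∈ K' ∩ L', w b := Finset.sum_nonneg fun b _ => hw b
  have hML'w : ∑ b ∈ K' ∩ L', w b ≤ ∑ b ∈ L', w b := sum_le_sum_of_subset' w hw Finset.inter_subset_right
  have hMK'w : ∑ b ∈ K' ∩ L', w b ≤ ∑ b ∈ K', w b := sum_le_sum_of_subset' w hw Finset.inter_subset_left
  have hl'p' : ∑ b ∈ L', w b ≤ ∑ b ∈ P', w b := sum_le_sum_of_subset' w hw hLP'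
  have hk'p' : ∑ b ∈ K', w b ≤ ∑ b ∈ P', w b := sum_le_sum_of_subset' w hw hKP'
  have hcE' := trace_diff_le w V L' (K' ∩ L') hw Finset.inter_subset_right
  have hcE := trace_diff_le w V K' (K' ∩ L') hw Finset.inter_subset_left
  have haM'L' : ∑ b ∈ (K' ∩ L') ∩ V, w b ≤ ∑ b ∈ L' ∩ V, w b :=
    sum_le_sum_of_subset' w hw (Finset.inter_subset_inter Finset.inter_subset_right le_rfl)
  have haM'K' : ∑ b ∈ (K' ∩ L') ∩ V, w b ≤ ∑ b ∈ K' ∩ V, w b :=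
    sum_le_sum_of_subset' w hw (Finset.inter_subset_inter Finset.inter_subset_left le_rfl)
  have haO'M' : ∑ b ∈ O' ∩ V, w b ≤ ∑ b ∈ (K' ∩ L') ∩ V, w b :=
    sum_le_sum_of_subset' w hw (Finset.inter_subset_inter (Finset.subset_inter hOK' hOL') le_rfl)
  have hmod := modularity_nested w V P K P' O' (fun b _ => hw b) hKP (hOK'.trans hKP')
  have hKO' : (K ∩ O') ∩ V = (O ∩ O') ∩ V := by
    ext b; simp only [Finset.mem_inter]; constructor
    · rintro ⟨⟨h1, h2⟩, h3⟩; by_cases hb : b ∈ O; · exact ⟨⟨hb, h2⟩, h3⟩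
      have hm : b ∈ (O' ∩ (K \ O)) ∩ V := by simp only [Finset.mem_inter, Finset.mem_sdiff]; exact ⟨⟨h2, h1, hb⟩, h3⟩
      rw [hO'V] at hm; exact absurd hm (Finset.notMem_empty b)
    · rintro ⟨⟨h1, h2⟩, h3⟩; exact ⟨⟨(hOL.trans hLK) h1, h2⟩, h3⟩
  rw [hKO'] at hmod
  set p := ∑ b ∈ P, w b
  set k := ∑ b ∈ K, w b
  set l := ∑ b ∈ L, w b
  set v := ∑ b ∈ V, w b
  set aK := ∑ b ∈ K ∩ V, w b
  set aL := ∑ b ∈ L ∩ V, w b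
  set aO := ∑ b ∈ O ∩ V, w b
  set p' := ∑ b ∈ P', w b
  set k' := ∑ b ∈ K', w b
  set l' := ∑ b ∈ L', w b
  set m' := ∑ b ∈ K' ∩ L', w b
  set aP' := ∑ b ∈ P' ∩ V, w b
  set aK' := ∑ b ∈ K' ∩ V, w b
  set aL' := ∑ b ∈ L' ∩ V, w b
  set aM' := ∑ b ∈ (K' ∩ L') ∩ V, w b
  set aO' := ∑ b ∈ O' ∩ V, w b
  have F2 : (l' - m') * (aK - aL) ≤ p' * (aK - aO) := by
    have h1 : aK - aL ≤ aK - aO := by linarith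
    have h3 : l' - m' ≤ p' := by linarith
    calc (l' - m') * (aK - aL) ≤ (l' - m') * (aK - aO) := mul_le_mul_of_nonneg_left h1 (by linarith)
      _ ≤ p' * (aK - aO) := mul_le_mul_of_nonneg_right h3 (by linarith)
  have F3 : 0 ≤ (k - l) * ((l' - m') - (aL' - aM')) := mul_nonneg (by linarith) (by linarith)
  have F4 : 0 ≤ (1 - v) * (Y - (k - l) * (l' - m')) := mul_nonneg (by linarith) (by linarith)
  nlinarith [hsup, hpair₁, hpair₂, hmod, hHarPO', hHarP'K, F2, F3, F4]

/-- **Nested unprimed side `L ⊆ K`, corner `O` with trace off the INNER primed annulus (`O ∩ V ∩ (L'∖O') = ∅`; `O` may meet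
`P'∖L'`).**  Packing `(K, K'∩L')`, `(L, K'∪L')`; Harris for `(P, L'∩V)` and `(P', O∩V)`; bracket `Y ≥ (w(K)−w(L))·(w(L')−w(K'∩L'))`.
Proof: `X_a ≥ Har(P;L'_V) + Har(P';O_V) + w(P)·(a(L')−a(O'))`. [this work] -/
theorem exchange_nestedLK_cornerInnerO [Fintype B] (w R : B → ℝ) (hw : ∀ b, 0 ≤ w b) (hw1 : ∑ b, w b = 1)
    (V K L P O K' L' P' O' : Finset B) (Y : ℝ) (hR : ∀ b ∈ V, 0 ≤ R b)
    (hOP : O ⊆ P) (hLK : L ⊆ K) (hKP : K ⊆ P) (hOK' : O' ⊆ K') (hOL' : O' ⊆ L') (hKP' : K' ⊆ P') (hLP' : L' ⊆ P')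
    (hOV : (O ∩ (L' \ O')) ∩ V = ∅)
    (hHarP'O : (∑ b ∈ P', w b) * (∑ b ∈ O ∩ V, w b) ≤ ∑ b ∈ (O ∩ P') ∩ V, w b)
    (hHarPL' : (∑ b ∈ P, w b) * (∑ b ∈ L' ∩ V, w b) ≤ ∑ b ∈ (P ∩ L') ∩ V, w b)
    (hpair₁ : (∑ b ∈ K, w b) * (∑ b ∈ (K' ∩ L') ∩ V, w b) + (∑ b ∈ K' ∩ L', w b) * (∑ b ∈ K ∩ V, w b)
        - (∑ b ∈ V, w b) * (∑ b ∈ K, w b) * (∑ b ∈ K' ∩ L', w b) ≤ ∑ b ∈ (K ∩ (K' ∩ L')) ∩ V, R b)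
    (hpair₂ : (∑ b ∈ L, w b) * (∑ b ∈ (K' ∪ L') ∩ V, w b) + (∑ b ∈ K' ∪ L', w b) * (∑ b ∈ L ∩ V, w b)
        - (∑ b ∈ V, w b) * (∑ b ∈ L, w b) * (∑ b ∈ K' ∪ L', w b) ≤ ∑ b ∈ (L ∩ (K' ∪ L')) ∩ V, R b)
    (hY : ((∑ b ∈ K, w b) - ∑ b ∈ L, w b) * ((∑ b ∈ L', w b) - ∑ b ∈ K' ∩ L', w b) ≤ Y) :
    0 ≤ (∑ b ∈ (P ∩ P') ∩ V, w b) + (∑ b ∈ (O ∩ O') ∩ V, w b)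
        - (∑ b ∈ P, w b) * (∑ b ∈ O' ∩ V, w b) - (∑ b ∈ P', w b) * (∑ b ∈ O ∩ V, w b)
        + (∑ b ∈ (K ∩ K') ∩ V, R b) + (∑ b ∈ (L ∩ L') ∩ V, R b)
        - ((∑ b ∈ K, w b) * (∑ b ∈ L' ∩ V, w b) + (∑ b ∈ L', w b) * (∑ b ∈ K ∩ V, w b)
            - (∑ b ∈ V, w b) * (∑ b ∈ K, w b) * (∑ b ∈ L', w b))
        - ((∑ b ∈ L, w b) * (∑ b ∈ K' ∩ V, w b) + (∑ b ∈ K', w b) * (∑ b ∈ L ∩ V, w b)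
            - (∑ b ∈ V, w b) * (∑ b ∈ L, w b) * (∑ b ∈ K', w b))
        + (1 - ∑ b ∈ V, w b) * Y := by
  have hsup := nestedLK_footprints_le_supply R V K L K' L' hR hLK
  have hcD := trace_diff_le w V K L hw hLK
  have hlk : ∑ b ∈ L, w b ≤ ∑ b ∈ K, w b := sum_le_sum_of_subset' w hw hLK
  have hkp : ∑ b ∈ K, w b ≤ ∑ b ∈ P, w b := sum_le_sum_of_subset' w hw hKP
  have haLK : ∑ b ∈ L ∩ V, w b ≤ ∑ b ∈ K ∩ V, w b := sum_le_sum_of_subset' w hw (Finset.inter_subset_inter hLK le_rfl)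
  have hJ : ∑ b ∈ K' ∪ L', w b = ∑ b ∈ K', w b + ∑ b ∈ L', w b - ∑ b ∈ K' ∩ L', w b := by
    have := sum_union_trace w (Finset.univ : Finset B) K' L'
    simpa only [Finset.inter_univ] using this
  have hJV := sum_union_trace w V K' L'
  rw [hJ, hJV] at hpair₂
  have h4 : ∑ b ∈ K', w b + ∑ b ∈ L', w b ≤ ∑ b ∈ P', w b + ∑ b ∈ K' ∩ L', w b := by
    have := union_inter_le w (Finset.univ : Finset B) K' L' P' (fun b _ => hw b) hKP' hLP'
    simpa only [Finset.inter_univ] using this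
  have hv1 : ∑ b ∈ V, w b ≤ 1 := by
    rw [← hw1]; exact sum_le_sum_of_subset' w hw (Finset.subset_univ V)
  have hk0 : 0 ≤ ∑ b ∈ K, w b := Finset.sum_nonneg fun b _ => hw b
  have hl0 : 0 ≤ ∑ b ∈ L, w b := Finset.sum_nonneg fun b _ => hw b
  have hp0 : 0 ≤ ∑ b ∈ P, w b := Finset.sum_nonneg fun b _ => hw b
  have hp'0 : 0 ≤ ∑ b ∈ P', w b := Finset.sum_nonneg fun b _ => hw b
  have hk'0 : 0 ≤ ∑ b ∈ K', w b := Finset.sum_nonneg fun b _ => hw b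
  have hl'0 : 0 ≤ ∑ b ∈ L', w b := Finset.sum_nonneg fun b _ => hw b
  have hm'0 : 0 ≤ ∑ b ∈ K' ∩ L', w b := Finset.sum_nonneg fun b _ => hw b
  have hML'w : ∑ b ∈ K' ∩ L', w b ≤ ∑ b ∈ L', w b := sum_le_sum_of_subset' w hw Finset.inter_subset_right
  have hMK'w : ∑ b ∈ K' ∩ L', w b ≤ ∑ b ∈ K', w b := sum_le_sum_of_subset' w hw Finset.inter_subset_left
  have hl'p' : ∑ b ∈ L', w b ≤ ∑ b ∈ P', w b := sum_le_sum_of_subset' w hw hLP'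
  have hk'p' : ∑ b ∈ K', w b ≤ ∑ b ∈ P', w b := sum_le_sum_of_subset' w hw hKP'
  have hcE' := trace_diff_le w V L' (K' ∩ L') hw Finset.inter_subset_right
  have hcE := trace_diff_le w V K' (K' ∩ L') hw Finset.inter_subset_left
  have haM'L' : ∑ b ∈ (K' ∩ L') ∩ V, w b ≤ ∑ b ∈ L' ∩ V, w b :=
    sum_le_sum_of_subset' w hw (Finset.inter_subset_inter Finset.inter_subset_right le_rfl)
  have haM'K' : ∑ b ∈ (K' ∩ L') ∩ V, w b ≤ ∑ b ∈ K' ∩ V, w b :=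
    sum_le_sum_of_subset' w hw (Finset.inter_subset_inter Finset.inter_subset_left le_rfl)
  have haO'M' : ∑ b ∈ O' ∩ V, w b ≤ ∑ b ∈ (K' ∩ L') ∩ V, w b :=
    sum_le_sum_of_subset' w hw (Finset.inter_subset_inter (Finset.subset_inter hOK' hOL') le_rfl)
  have hmod := modularity_nested w V P O P' L' (fun b _ => hw b) hOP hLP'
  have hL'O : (L' ∩ O) ∩ V = (O' ∩ O) ∩ V := by
    ext b; simp only [Finset.mem_inter]; constructor
    · rintro ⟨⟨h1, h2⟩, h3⟩; by_cases hb : b ∈ O'; · exact ⟨⟨hb, h2⟩, h3⟩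
      have hm : b ∈ (O ∩ (L' \ O')) ∩ V := by simp only [Finset.mem_inter, Finset.mem_sdiff]; exact ⟨⟨h2, h1, hb⟩, h3⟩
      rw [hOV] at hm; exact absurd hm (Finset.notMem_empty b)
    · rintro ⟨⟨h1, h2⟩, h3⟩; exact ⟨⟨hOL' h1, h2⟩, h3⟩
  have hc1 : (O ∩ L') ∩ V = (L' ∩ O) ∩ V := by rw [Finset.inter_comm O L']
  have hc2 : (O' ∩ O) ∩ V = (O ∩ O') ∩ V := by rw [Finset.inter_comm O' O]
  rw [hc1, hL'O, hc2] at hmod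
  set p := ∑ b ∈ P, w b
  set k := ∑ b ∈ K, w b
  set l := ∑ b ∈ L, w b
  set v := ∑ b ∈ V, w b
  set aK := ∑ b ∈ K ∩ V, w b
  set aL := ∑ b ∈ L ∩ V, w b
  set aO := ∑ b ∈ O ∩ V, w b
  set p' := ∑ b ∈ P', w b
  set k' := ∑ b ∈ K', w b
  set l' := ∑ b ∈ L', w b
  set m' := ∑ b ∈ K' ∩ L', w b
  set aP' := ∑ b ∈ P' ∩ V, w b
  set aK' := ∑ b ∈ K' ∩ V, w b
  set aL' := ∑ b ∈ L' ∩ V, w b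
  set aM' := ∑ b ∈ (K' ∩ L') ∩ V, w b
  set aO' := ∑ b ∈ O' ∩ V, w b
  have F2 : (k - l) * (aL' - aM') ≤ p * (aL' - aO') := by
    have h1 : aL' - aM' ≤ aL' - aO' := by linarith
    have h3 : k - l ≤ p := by linarith
    calc (k - l) * (aL' - aM') ≤ (k - l) * (aL' - aO') := mul_le_mul_of_nonneg_left h1 (by linarith)
      _ ≤ p * (aL' - aO') := mul_le_mul_of_nonneg_right h3 (by linarith)
  have F3 : 0 ≤ (l' - m') * ((k - l) - (aK - aL)) := mul_nonneg (by linarith) (by linarith)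
  have F4 : 0 ≤ (1 - v) * (Y - (k - l) * (l' - m')) := mul_nonneg (by linarith) (by linarith)
  nlinarith [hsup, hpair₁, hpair₂, hmod, hHarP'O, hHarPL', F2, F3, F4]

/-- **Nested unprimed side `K ⊆ L`, corner `O` with trace off the INNER primed annulus (`O ∩ V ∩ (K'∖O') = ∅`).**  Packing
`(L, K'∩L')`, `(K, K'∪L')`; Harris for `(P, K'∩V)` and `(P', O∩V)`; bracket `Y ≥ (w(L)−w(K))·(w(K')−w(K'∩L'))`. [this work] -/
theorem exchange_nestedKL_cornerInnerO [Fintype B] (w R : B → ℝ) (hw : ∀ b, 0 ≤ w b) (hw1 : ∑ b, w b = 1)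
    (V K L P O K' L' P' O' : Finset B) (Y : ℝ) (hR : ∀ b ∈ V, 0 ≤ R b)
    (hOP : O ⊆ P) (hKL : K ⊆ L) (hLP : L ⊆ P) (hOK' : O' ⊆ K') (hOL' : O' ⊆ L') (hKP' : K' ⊆ P') (hLP' : L' ⊆ P')
    (hOV : (O ∩ (K' \ O')) ∩ V = ∅)
    (hHarP'O : (∑ b ∈ P', w b) * (∑ b ∈ O ∩ V, w b) ≤ ∑ b ∈ (O ∩ P') ∩ V, w b)
    (hHarPK' : (∑ b ∈ P, w b) * (∑ b ∈ K' ∩ V, w b) ≤ ∑ b ∈ (P ∩ K') ∩ V, w b)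
    (hpair₁ : (∑ b ∈ L, w b) * (∑ b ∈ (K' ∩ L') ∩ V, w b) + (∑ b ∈ K' ∩ L', w b) * (∑ b ∈ L ∩ V, w b)
        - (∑ b ∈ V, w b) * (∑ b ∈ L, w b) * (∑ b ∈ K' ∩ L', w b) ≤ ∑ b ∈ (L ∩ (K' ∩ L')) ∩ V, R b)
    (hpair₂ : (∑ b ∈ K, w b) * (∑ b ∈ (K' ∪ L') ∩ V, w b) + (∑ b ∈ K' ∪ L', w b) * (∑ b ∈ K ∩ V, w b)
        - (∑ b ∈ V, w b) * (∑ b ∈ K, w b) * (∑ b ∈ K' ∪ L', w b) ≤ ∑ b ∈ (K ∩ (K' ∪ L')) ∩ V, R b)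
    (hY : ((∑ b ∈ L, w b) - ∑ b ∈ K, w b) * ((∑ b ∈ K', w b) - ∑ b ∈ K' ∩ L', w b) ≤ Y) :
    0 ≤ (∑ b ∈ (P ∩ P') ∩ V, w b) + (∑ b ∈ (O ∩ O') ∩ V, w b)
        - (∑ b ∈ P, w b) * (∑ b ∈ O' ∩ V, w b) - (∑ b ∈ P', w b) * (∑ b ∈ O ∩ V, w b)
        + (∑ b ∈ (K ∩ K') ∩ V, R b) + (∑ b ∈ (L ∩ L') ∩ V, R b)
        - ((∑ b ∈ K, w b) * (∑ b ∈ L' ∩ V, w b) + (∑ b ∈ L', w b) * (∑ b ∈ K ∩ V, w b)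
            - (∑ b ∈ V, w b) * (∑ b ∈ K, w b) * (∑ b ∈ L', w b))
        - ((∑ b ∈ L, w b) * (∑ b ∈ K' ∩ V, w b) + (∑ b ∈ K', w b) * (∑ b ∈ L ∩ V, w b)
            - (∑ b ∈ V, w b) * (∑ b ∈ L, w b) * (∑ b ∈ K', w b))
        + (1 - ∑ b ∈ V, w b) * Y := by
  have hsup := nestedKL_footprints_le_supply R V K L K' L' hR hKL
  have hcD := trace_diff_le w V L K hw hKL
  have hkl : ∑ b ∈ K, w b ≤ ∑ b ∈ L, w b := sum_le_sum_of_subset' w hw hKL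
  have hlp : ∑ b ∈ L, w b ≤ ∑ b ∈ P, w b := sum_le_sum_of_subset' w hw hLP
  have haKL : ∑ b ∈ K ∩ V, w b ≤ ∑ b ∈ L ∩ V, w b := sum_le_sum_of_subset' w hw (Finset.inter_subset_inter hKL le_rfl)
  have hJ : ∑ b ∈ K' ∪ L', w b = ∑ b ∈ K', w b + ∑ b ∈ L', w b - ∑ b ∈ K' ∩ L', w b := by
    have := sum_union_trace w (Finset.univ : Finset B) K' L'
    simpa only [Finset.inter_univ] using this
  have hJV := sum_union_trace w V K' L'
  rw [hJ, hJV] at hpair₂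
  have h4 : ∑ b ∈ K', w b + ∑ b ∈ L', w b ≤ ∑ b ∈ P', w b + ∑ b ∈ K' ∩ L', w b := by
    have := union_inter_le w (Finset.univ : Finset B) K' L' P' (fun b _ => hw b) hKP' hLP'
    simpa only [Finset.inter_univ] using this
  have hv1 : ∑ b ∈ V, w b ≤ 1 := by
    rw [← hw1]; exact sum_le_sum_of_subset' w hw (Finset.subset_univ V)
  have hk0 : 0 ≤ ∑ b ∈ K, w b := Finset.sum_nonneg fun b _ => hw b
  have hl0 : 0 ≤ ∑ b ∈ L, w b := Finset.sum_nonneg fun b _ => hw b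
  have hp0 : 0 ≤ ∑ b ∈ P, w b := Finset.sum_nonneg fun b _ => hw b
  have hp'0 : 0 ≤ ∑ b ∈ P', w b := Finset.sum_nonneg fun b _ => hw b
  have hk'0 : 0 ≤ ∑ b ∈ K', w b := Finset.sum_nonneg fun b _ => hw b
  have hl'0 : 0 ≤ ∑ b ∈ L', w b := Finset.sum_nonneg fun b _ => hw b
  have hm'0 : 0 ≤ ∑ b ∈ K' ∩ L', w b := Finset.sum_nonneg fun b _ => hw b
  have hML'w : ∑ b ∈ K' ∩ L', w b ≤ ∑ b ∈ L', w b := sum_le_sum_of_subset' w hw Finset.inter_subset_right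
  have hMK'w : ∑ b ∈ K' ∩ L', w b ≤ ∑ b ∈ K', w b := sum_le_sum_of_subset' w hw Finset.inter_subset_left
  have hl'p' : ∑ b ∈ L', w b ≤ ∑ b ∈ P', w b := sum_le_sum_of_subset' w hw hLP'
  have hk'p' : ∑ b ∈ K', w b ≤ ∑ b ∈ P', w b := sum_le_sum_of_subset' w hw hKP'
  have hcE' := trace_diff_le w V L' (K' ∩ L') hw Finset.inter_subset_right
  have hcE := trace_diff_le w V K' (K' ∩ L') hw Finset.inter_subset_left
  have haM'L' : ∑ b ∈ (K' ∩ L') ∩ V, w b ≤ ∑ b ∈ L' ∩ V, w b :=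
    sum_le_sum_of_subset' w hw (Finset.inter_subset_inter Finset.inter_subset_right le_rfl)
  have haM'K' : ∑ b ∈ (K' ∩ L') ∩ V, w b ≤ ∑ b ∈ K' ∩ V, w b :=
    sum_le_sum_of_subset' w hw (Finset.inter_subset_inter Finset.inter_subset_left le_rfl)
  have haO'M' : ∑ b ∈ O' ∩ V, w b ≤ ∑ b ∈ (K' ∩ L') ∩ V, w b :=
    sum_le_sum_of_subset' w hw (Finset.inter_subset_inter (Finset.subset_inter hOK' hOL') le_rfl)
  have hmod := modularity_nested w V P O P' K' (fun b _ => hw b) hOP hKP'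
  have hK'O : (K' ∩ O) ∩ V = (O' ∩ O) ∩ V := by
    ext b; simp only [Finset.mem_inter]; constructor
    · rintro ⟨⟨h1, h2⟩, h3⟩; by_cases hb : b ∈ O'; · exact ⟨⟨hb, h2⟩, h3⟩
      have hm : b ∈ (O ∩ (K' \ O')) ∩ V := by simp only [Finset.mem_inter, Finset.mem_sdiff]; exact ⟨⟨h2, h1, hb⟩, h3⟩
      rw [hOV] at hm; exact absurd hm (Finset.notMem_empty b)
    · rintro ⟨⟨h1, h2⟩, h3⟩; exact ⟨⟨hOK' h1, h2⟩, h3⟩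
  have hc1 : (O ∩ K') ∩ V = (K' ∩ O) ∩ V := by rw [Finset.inter_comm O K']
  have hc2 : (O' ∩ O) ∩ V = (O ∩ O') ∩ V := by rw [Finset.inter_comm O' O]
  rw [hc1, hK'O, hc2] at hmod
  set p := ∑ b ∈ P, w b
  set k := ∑ b ∈ K, w b
  set l := ∑ b ∈ L, w b
  set v := ∑ b ∈ V, w b
  set aK := ∑ b ∈ K ∩ V, w b
  set aL := ∑ b ∈ L ∩ V, w b
  set aO := ∑ b ∈ O ∩ V, w b
  set p' := ∑ b ∈ P', w b
  set k' := ∑ b ∈ K', w b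
  set l' := ∑ b ∈ L', w b
  set m' := ∑ b ∈ K' ∩ L', w b
  set aP' := ∑ b ∈ P' ∩ V, w b
  set aK' := ∑ b ∈ K' ∩ V, w b
  set aL' := ∑ b ∈ L' ∩ V, w b
  set aM' := ∑ b ∈ (K' ∩ L') ∩ V, w b
  set aO' := ∑ b ∈ O' ∩ V, w b
  have F2 : (l - k) * (aK' - aM') ≤ p * (aK' - aO') := by
    have h1 : aK' - aM' ≤ aK' - aO' := by linarith
    have h3 : l - k ≤ p := by linarith
    calc (l - k) * (aK' - aM') ≤ (l - k) * (aK' - aO') := mul_le_mul_of_nonneg_left h1 (by linarith)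
      _ ≤ p * (aK' - aO') := mul_le_mul_of_nonneg_right h3 (by linarith)
  have F3 : 0 ≤ (k' - m') * ((l - k) - (aL - aK)) := mul_nonneg (by linarith) (by linarith)
  have F4 : 0 ≤ (1 - v) * (Y - (l - k) * (k' - m')) := mul_nonneg (by linarith) (by linarith)
  nlinarith [hsup, hpair₁, hpair₂, hmod, hHarP'O, hHarPK', F2, F3, F4]

/-- **Nested unprimed side `K ⊆ L`, corner `O'` with trace off the INNER unprimed annulus (`O' ∩ V ∩ (L∖O) = ∅`).**  Packing
`(L, K'∩L')`, `(K, K'∪L')`; Harris for `(P', L∩V)` and `(P, O'∩V)`; bracket `Y ≥ (w(L)−w(K))·(w(K')−w(K'∩L'))`. [this work] -/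
theorem exchange_nestedKL_cornerInnerO' [Fintype B] (w R : B → ℝ) (hw : ∀ b, 0 ≤ w b) (hw1 : ∑ b, w b = 1)
    (V K L P O K' L' P' O' : Finset B) (Y : ℝ) (hR : ∀ b ∈ V, 0 ≤ R b)
    (hOK : O ⊆ K) (hKL : K ⊆ L) (hLP : L ⊆ P) (hOK' : O' ⊆ K') (hOL' : O' ⊆ L') (hKP' : K' ⊆ P') (hLP' : L' ⊆ P')
    (hO'V : (O' ∩ (L \ O)) ∩ V = ∅)
    (hHarPO' : (∑ b ∈ P, w b) * (∑ b ∈ O' ∩ V, w b) ≤ ∑ b ∈ (P ∩ O') ∩ V, w b)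
    (hHarP'L : (∑ b ∈ P', w b) * (∑ b ∈ L ∩ V, w b) ≤ ∑ b ∈ (L ∩ P') ∩ V, w b)
    (hpair₁ : (∑ b ∈ L, w b) * (∑ b ∈ (K' ∩ L') ∩ V, w b) + (∑ b ∈ K' ∩ L', w b) * (∑ b ∈ L ∩ V, w b)
        - (∑ b ∈ V, w b) * (∑ b ∈ L, w b) * (∑ b ∈ K' ∩ L', w b) ≤ ∑ b ∈ (L ∩ (K' ∩ L')) ∩ V, R b)
    (hpair₂ : (∑ b ∈ K, w b) * (∑ b ∈ (K' ∪ L') ∩ V, w b) + (∑ b ∈ K' ∪ L', w b) * (∑ b ∈ K ∩ V, w b)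
        - (∑ b ∈ V, w b) * (∑ b ∈ K, w b) * (∑ b ∈ K' ∪ L', w b) ≤ ∑ b ∈ (K ∩ (K' ∪ L')) ∩ V, R b)
    (hY : ((∑ b ∈ L, w b) - ∑ b ∈ K, w b) * ((∑ b ∈ K', w b) - ∑ b ∈ K' ∩ L', w b) ≤ Y) :
    0 ≤ (∑ b ∈ (P ∩ P') ∩ V, w b) + (∑ b ∈ (O ∩ O') ∩ V, w b)
        - (∑ b ∈ P, w b) * (∑ b ∈ O' ∩ V, w b) - (∑ b ∈ P', w b) * (∑ b ∈ O ∩ V, w b)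
        + (∑ b ∈ (K ∩ K') ∩ V, R b) + (∑ b ∈ (L ∩ L') ∩ V, R b)
        - ((∑ b ∈ K, w b) * (∑ b ∈ L' ∩ V, w b) + (∑ b ∈ L', w b) * (∑ b ∈ K ∩ V, w b)
            - (∑ b ∈ V, w b) * (∑ b ∈ K, w b) * (∑ b ∈ L', w b))
        - ((∑ b ∈ L, w b) * (∑ b ∈ K' ∩ V, w b) + (∑ b ∈ K', w b) * (∑ b ∈ L ∩ V, w b)
            - (∑ b ∈ V, w b) * (∑ b ∈ L, w b) * (∑ b ∈ K', w b))
        + (1 - ∑ b ∈ V, w b) * Y := by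
  have hsup := nestedKL_footprints_le_supply R V K L K' L' hR hKL
  have hcD := trace_diff_le w V L K hw hKL
  have hkl : ∑ b ∈ K, w b ≤ ∑ b ∈ L, w b := sum_le_sum_of_subset' w hw hKL
  have hlp : ∑ b ∈ L, w b ≤ ∑ b ∈ P, w b := sum_le_sum_of_subset' w hw hLP
  have haKL : ∑ b ∈ K ∩ V, w b ≤ ∑ b ∈ L ∩ V, w b := sum_le_sum_of_subset' w hw (Finset.inter_subset_inter hKL le_rfl)
  have haOK : ∑ b ∈ O ∩ V, w b ≤ ∑ b ∈ K ∩ V, w b := sum_le_sum_of_subset' w hw (Finset.inter_subset_inter hOK le_rfl)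
  have hJ : ∑ b ∈ K' ∪ L', w b = ∑ b ∈ K', w b + ∑ b ∈ L', w b - ∑ b ∈ K' ∩ L', w b := by
    have := sum_union_trace w (Finset.univ : Finset B) K' L'
    simpa only [Finset.inter_univ] using this
  have hJV := sum_union_trace w V K' L'
  rw [hJ, hJV] at hpair₂
  have h4 : ∑ b ∈ K', w b + ∑ b ∈ L', w b ≤ ∑ b ∈ P', w b + ∑ b ∈ K' ∩ L', w b := by
    have := union_inter_le w (Finset.univ : Finset B) K' L' P' (fun b _ => hw b) hKP' hLP'
    simpa only [Finset.inter_univ] using this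
  have hv1 : ∑ b ∈ V, w b ≤ 1 := by
    rw [← hw1]; exact sum_le_sum_of_subset' w hw (Finset.subset_univ V)
  have hk0 : 0 ≤ ∑ b ∈ K, w b := Finset.sum_nonneg fun b _ => hw b
  have hl0 : 0 ≤ ∑ b ∈ L, w b := Finset.sum_nonneg fun b _ => hw b
  have hp0 : 0 ≤ ∑ b ∈ P, w b := Finset.sum_nonneg fun b _ => hw b
  have hp'0 : 0 ≤ ∑ b ∈ P', w b := Finset.sum_nonneg fun b _ => hw b
  have hk'0 : 0 ≤ ∑ b ∈ K', w b := Finset.sum_nonneg fun b _ => hw b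
  have hl'0 : 0 ≤ ∑ b ∈ L', w b := Finset.sum_nonneg fun b _ => hw b
  have hm'0 : 0 ≤ ∑ b ∈ K' ∩ L', w b := Finset.sum_nonneg fun b _ => hw b
  have hML'w : ∑ b ∈ K' ∩ L', w b ≤ ∑ b ∈ L', w b := sum_le_sum_of_subset' w hw Finset.inter_subset_right
  have hMK'w : ∑ b ∈ K' ∩ L', w b ≤ ∑ b ∈ K', w b := sum_le_sum_of_subset' w hw Finset.inter_subset_left
  have hl'p' : ∑ b ∈ L', w b ≤ ∑ b ∈ P', w b := sum_le_sum_of_subset' w hw hLP'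
  have hk'p' : ∑ b ∈ K', w b ≤ ∑ b ∈ P', w b := sum_le_sum_of_subset' w hw hKP'
  have hcE' := trace_diff_le w V L' (K' ∩ L') hw Finset.inter_subset_right
  have hcE := trace_diff_le w V K' (K' ∩ L') hw Finset.inter_subset_left
  have haM'L' : ∑ b ∈ (K' ∩ L') ∩ V, w b ≤ ∑ b ∈ L' ∩ V, w b :=
    sum_le_sum_of_subset' w hw (Finset.inter_subset_inter Finset.inter_subset_right le_rfl)
  have haM'K' : ∑ b ∈ (K' ∩ L') ∩ V, w b ≤ ∑ b ∈ K' ∩ V, w b :=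
    sum_le_sum_of_subset' w hw (Finset.inter_subset_inter Finset.inter_subset_left le_rfl)
  have haO'M' : ∑ b ∈ O' ∩ V, w b ≤ ∑ b ∈ (K' ∩ L') ∩ V, w b :=
    sum_le_sum_of_subset' w hw (Finset.inter_subset_inter (Finset.subset_inter hOK' hOL') le_rfl)
  have hmod := modularity_nested w V P L P' O' (fun b _ => hw b) hLP (hOK'.trans hKP')
  have hLO' : (L ∩ O') ∩ V = (O ∩ O') ∩ V := by
    ext b; simp only [Finset.mem_inter]; constructor
    · rintro ⟨⟨h1, h2⟩, h3⟩; by_cases hb : b ∈ O; · exact ⟨⟨hb, h2⟩, h3⟩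
      have hm : b ∈ (O' ∩ (L \ O)) ∩ V := by simp only [Finset.mem_inter, Finset.mem_sdiff]; exact ⟨⟨h2, h1, hb⟩, h3⟩
      rw [hO'V] at hm; exact absurd hm (Finset.notMem_empty b)
    · rintro ⟨⟨h1, h2⟩, h3⟩; exact ⟨⟨(hOK.trans hKL) h1, h2⟩, h3⟩
  rw [hLO'] at hmod
  set p := ∑ b ∈ P, w b
  set k := ∑ b ∈ K, w b
  set l := ∑ b ∈ L, w b
  set v := ∑ b ∈ V, w b
  set aK := ∑ b ∈ K ∩ V, w b
  set aL := ∑ b ∈ L ∩ V, w b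
  set aO := ∑ b ∈ O ∩ V, w b
  set p' := ∑ b ∈ P', w b
  set k' := ∑ b ∈ K', w b
  set l' := ∑ b ∈ L', w b
  set m' := ∑ b ∈ K' ∩ L', w b
  set aP' := ∑ b ∈ P' ∩ V, w b
  set aK' := ∑ b ∈ K' ∩ V, w b
  set aL' := ∑ b ∈ L' ∩ V, w b
  set aM' := ∑ b ∈ (K' ∩ L') ∩ V, w b
  set aO' := ∑ b ∈ O' ∩ V, w b
  have F2 : (k' - m') * (aL - aK) ≤ p' * (aL - aO) := by
    have h1 : aL - aK ≤ aL - aO := by linarith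
    have h3 : k' - m' ≤ p' := by linarith
    calc (k' - m') * (aL - aK) ≤ (k' - m') * (aL - aO) := mul_le_mul_of_nonneg_left h1 (by linarith)
      _ ≤ p' * (aL - aO) := mul_le_mul_of_nonneg_right h3 (by linarith)
  have F3 : 0 ≤ (l - k) * ((k' - m') - (aK' - aM')) := mul_nonneg (by linarith) (by linarith)
  have F4 : 0 ≤ (1 - v) * (Y - (l - k) * (k' - m')) := mul_nonneg (by linarith) (by linarith)
  nlinarith [hsup, hpair₁, hpair₂, hmod, hHarPO', hHarP'L, F2, F3, F4]

end Summit.CriticalPhenomena.PercolationContinuityZ3.Theorems.SahiE3ExchangeNestedInner
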